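import Mathlib.Geometry.Manifold.PartitionOfUnity
import Mathlib.Geometry.Manifold.ContMDiff.Atlas
import Mathlib.Geometry.Manifold.ContMDiff.NormedSpace
import Mathlib.Geometry.Manifold.Algebra.SMul
import Literature.Analysis.FunctionSpaces.ContDiffHolderSpace
import Literature.Analysis.FunctionSpaces.ContDiffHolderAlgebra
import HarnessLib

/-!
# Hölder spaces `C^{k,r}(M)` on a compact manifold, through a finite atlas (Hölder spaces, part 4)

Topic `Literature/Analysis/FunctionSpaces`. On a manifold `M` modelled on a real normed space `E`
(model `𝓘(ℝ, E)`, e.g. `𝓡 n`), fix **Hölder chart data** `𝔄 : HolderChartData ι E M`: finitely many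
chart centres `c i` and a smooth partition of unity `ρ` subordinate to the chart sources
`(chartAt E (c i)).source` (such data exist on every compact Hausdorff manifold over a
finite-dimensional model, `HolderChartData.exists_of_compactSpace`). A function `u : M → F` is cut into its
**chart pieces** `𝔄.piece u i = 𝟙_{target} · (ρ_i u) ∘ (chartAt E (c i))⁻¹ : E → F`, and

* `HolderManifoldFunction 𝔄 F k r` — the space `C^{k,r}_𝔄(M, F)` of `u : M → F` all of whose pieces
  lie in the Banach space `C^{k,r}_b(E, F)` of part 3 (`ContDiffHolderFunction`), with the
  pointwise real vector space structure and the norm `‖u‖ = max_i ‖piece u i‖_{C^{k,r}}` induced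
  by the injective linear map `toPieces` into `Π i, C^{k,r}_b(E, F)` (injective because
  `∑ i, ρ i = 1`: `u x = ∑ i, ρ i x • u x` and every term is a value of a piece);
* `norm_apply_le` (`‖u x‖ ≤ card ι · ‖u‖`);
* **completeness** (`instCompleteSpace`): along a Cauchy sequence the pieces converge in
  `Π i, C^{k,r}_b` to some `w`; the function `v x = ∑ i 𝟙_{source_i}(x) · w i (chart_i x)` is the
  pointwise limit of `u_n`, and its pieces ARE the `w i` (pointwise limits of the pieces), so `v`
  is a member and `u_n → v`;
* **smooth functions are members** (`HolderChartData.memContDiffHolder_piece_of_contMDiff`,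
  `HolderManifoldFunction.ofContMDiff`, for `r ≤ 1` on a compact manifold): a piece of a `C^∞`
  function is `C^∞` on `E` with compact support inside the chart target, hence has bounded
  derivatives of all orders and Lipschitz, hence `r`-Hölder, `k`-th derivative
  (`holderWith_iteratedFDeriv_of_eSupNorm_ne_top` of `ContDiffHolderAlgebra.lean`).

This is the standard definition of `C^{k,α}(M)` for compact `M` (e.g. Aubin 1998, §2.7 Def. 2.21 /
Gilbarg–Trudinger §6.1 on domains, read chartwise; Joyce 2007, §1.2): different data give
equivalent norms — NOT proved here (it needs the chart-transition estimates); consumers fix one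
`𝔄`. Everything is proved; no named facts. This is layer (1b) of the analytic core recorded in the
census of `Literature.Geometry.Riemannian.gurskyViaclovsky_pathOpen_weighted_four`.

## References

* D. D. Joyce, *Riemannian Holonomy Groups and Calibrated Geometry* (2007), §1.2 (Hölder spaces on
  compact manifolds). [Joyce2007]
* D. Gilbarg, N. S. Trudinger, *Elliptic Partial Differential Equations of Second Order* (2001),
  §4.1. [GilbargTrudinger2001]
-/

noncomputable section

open Set Filter Function
open scoped Manifold ContDiff Topology NNReal ENNReal

namespace Literature.Analysis.FunctionSpaces

/-- **Hölder chart data** on a manifold modelled on `E`: chart centres `c i` and a smooth partition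
of unity subordinate to the chart sources. [folklore] -/
structure HolderChartData (ι : Type*) (E : Type*) [NormedAddCommGroup E] [NormedSpace ℝ E]
    (M : Type*) [TopologicalSpace M] [ChartedSpace E M] where
  /-- The chart centres. -/
  center : ι → M
  /-- A smooth partition of unity indexed like the charts. -/
  ρ : SmoothPartitionOfUnity ι 𝓘(ℝ, E) M univ
  /-- The partition of unity is subordinate to the chart sources. -/
  isSubordinate : ρ.IsSubordinate fun i => (chartAt E (center i)).source

namespace HolderChartData

variable {ι : Type*} {E : Type*} [NormedAddCommGroup E] [NormedSpace ℝ E]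
  {M : Type*} [TopologicalSpace M] [ChartedSpace E M]
  {F : Type*} [NormedAddCommGroup F] [NormedSpace ℝ F]

/-- **Existence on compact manifolds**: a compact Hausdorff `C^∞` manifold over a
finite-dimensional model carries Hölder chart data indexed by a finite set of points (a finite
subcover by chart sources and Mathlib's `SmoothPartitionOfUnity.exists_isSubordinate`). [folklore] -/
theorem exists_of_compactSpace (E : Type*) [NormedAddCommGroup E] [NormedSpace ℝ E] [FiniteDimensional ℝ E]
    (M : Type*) [TopologicalSpace M] [ChartedSpace E M] [IsManifold 𝓘(ℝ, E) ∞ M] [T2Space M]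
    [CompactSpace M] : ∃ t : Finset M, Nonempty (HolderChartData t E M) := by
  obtain ⟨t, ht⟩ := isCompact_univ.elim_finite_subcover (fun x : M => (chartAt E x).source)
    (fun x => (chartAt E x).open_source) (fun x _ => mem_iUnion_of_mem x (mem_chart_source E x))
  refine ⟨t, ?_⟩
  obtain ⟨ρ, hρ⟩ := SmoothPartitionOfUnity.exists_isSubordinate 𝓘(ℝ, E) isClosed_univ
    (fun i : t => (chartAt E (i : M)).source) (fun i => (chartAt E (i : M)).open_source)
    (fun x _ => by
      obtain ⟨i, hi⟩ := mem_iUnion.1 (ht (mem_univ x))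
      obtain ⟨hi, hx⟩ := mem_iUnion.1 hi
      exact mem_iUnion_of_mem ⟨i, hi⟩ hx)
  exact ⟨⟨fun i => (i : M), ρ, hρ⟩⟩

variable (𝔄 : HolderChartData ι E M)

/-- Shorthand: the `i`-th chart of the data. [folklore] -/
abbrev chart (i : ι) := chartAt E (𝔄.center i)

/-- Outside the `i`-th chart source the `i`-th cutoff vanishes. [folklore] -/
theorem ρ_eq_zero {i : ι} {x : M} (hx : x ∉ (𝔄.chart i).source) : 𝔄.ρ i x = 0 :=
  image_eq_zero_of_notMem_tsupport fun h => hx (𝔄.isSubordinate i h)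

/-- `∑ i, ρ i x • w = w` (the cutoffs sum to `1`). [folklore] -/
theorem sum_smul_eq [Fintype ι] (x : M) (w : F) : ∑ i, 𝔄.ρ i x • w = w := by
  rw [← Finset.sum_smul, ← finsum_eq_sum_of_fintype, 𝔄.ρ.sum_eq_one (mem_univ x), one_smul]

/-- **The chart pieces** `piece u i = 𝟙_{target_i} · (ρ_i • u) ∘ chart_i⁻¹ : E → F`. [folklore] -/
def piece (u : M → F) (i : ι) : E → F :=
  (𝔄.chart i).target.indicator fun y => 𝔄.ρ i ((𝔄.chart i).symm y) • u ((𝔄.chart i).symm y)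

/-- A piece on the chart target. [folklore] -/
theorem piece_apply_of_mem (u : M → F) {i : ι} {y : E} (hy : y ∈ (𝔄.chart i).target) :
    𝔄.piece u i y = 𝔄.ρ i ((𝔄.chart i).symm y) • u ((𝔄.chart i).symm y) :=
  indicator_of_mem hy _

/-- A piece vanishes off the chart target. [folklore] -/
theorem piece_apply_of_not_mem (u : M → F) {i : ι} {y : E} (hy : y ∉ (𝔄.chart i).target) :
    𝔄.piece u i y = 0 :=
  indicator_of_notMem hy _

/-- **`ρ i x • u x` is a value of the `i`-th piece** (at `chart_i x`, for `x` in the source). [folklore] -/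
theorem smul_apply_eq_piece (u : M → F) {i : ι} {x : M} (hx : x ∈ (𝔄.chart i).source) :
    𝔄.ρ i x • u x = 𝔄.piece u i (𝔄.chart i x) := by
  rw [𝔄.piece_apply_of_mem u ((𝔄.chart i).map_source hx), (𝔄.chart i).left_inv hx]

/-- `ρ i x • u x` as an indicator of the chart source composed with the piece. [folklore] -/
theorem smul_apply_eq_indicator (u : M → F) (i : ι) (x : M) :
    𝔄.ρ i x • u x = (𝔄.chart i).source.indicator (fun x => 𝔄.piece u i (𝔄.chart i x)) x := by
  by_cases hx : x ∈ (𝔄.chart i).source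
  · rw [indicator_of_mem hx, 𝔄.smul_apply_eq_piece u hx]
  · rw [indicator_of_notMem hx, 𝔄.ρ_eq_zero hx, zero_smul]

/-- **Reconstruction**: `u x = ∑ i 𝟙_{source_i}(x) · piece u i (chart_i x)`. [folklore] -/
theorem apply_eq_sum_indicator_piece [Fintype ι] (u : M → F) (x : M) :
    u x = ∑ i, (𝔄.chart i).source.indicator (fun x => 𝔄.piece u i (𝔄.chart i x)) x := by
  conv_lhs => rw [← 𝔄.sum_smul_eq x (u x)]
  exact Finset.sum_congr rfl fun i _ => 𝔄.smul_apply_eq_indicator u i x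

/-- Pieces are additive. [folklore] -/
theorem piece_add (u v : M → F) (i : ι) : 𝔄.piece (u + v) i = 𝔄.piece u i + 𝔄.piece v i := by
  funext y
  by_cases hy : y ∈ (𝔄.chart i).target
  · simp only [Pi.add_apply, 𝔄.piece_apply_of_mem _ hy, smul_add]
  · simp only [Pi.add_apply, 𝔄.piece_apply_of_not_mem _ hy, add_zero]

/-- Pieces commute with negation. [folklore] -/
theorem piece_neg (u : M → F) (i : ι) : 𝔄.piece (-u) i = -𝔄.piece u i := by
  funext y
  by_cases hy : y ∈ (𝔄.chart i).target
  · simp only [Pi.neg_apply, 𝔄.piece_apply_of_mem _ hy, smul_neg]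
  · simp only [Pi.neg_apply, 𝔄.piece_apply_of_not_mem _ hy, neg_zero]

/-- Pieces are real-homogeneous. [folklore] -/
theorem piece_smul (a : ℝ) (u : M → F) (i : ι) : 𝔄.piece (a • u) i = a • 𝔄.piece u i := by
  funext y
  by_cases hy : y ∈ (𝔄.chart i).target
  · simp only [Pi.smul_apply, 𝔄.piece_apply_of_mem _ hy, smul_comm (𝔄.ρ i _) a]
  · simp only [Pi.smul_apply, 𝔄.piece_apply_of_not_mem _ hy, smul_zero]

/-- The pieces of `0` vanish. [folklore] -/
@[simp]
theorem piece_zero (i : ι) : 𝔄.piece (0 : M → F) i = 0 := by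
  funext y
  by_cases hy : y ∈ (𝔄.chart i).target
  · simp only [𝔄.piece_apply_of_mem _ hy, Pi.zero_apply, smul_zero]
  · simp only [𝔄.piece_apply_of_not_mem _ hy, Pi.zero_apply]

/-- Pieces commute with subtraction. [folklore] -/
theorem piece_sub (u v : M → F) (i : ι) : 𝔄.piece (u - v) i = 𝔄.piece u i - 𝔄.piece v i := by
  rw [sub_eq_add_neg, 𝔄.piece_add, 𝔄.piece_neg, ← sub_eq_add_neg]

end HolderChartData

/-! ### The space `C^{k,r}_𝔄(M, F)` -/

/-- **The Hölder space `C^{k,r}_𝔄(M, F)` of a compact manifold read in the chart data `𝔄`**: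
functions `u : M → F` all of whose chart pieces `𝔄.piece u i` lie in `C^{k,r}_b(E, F)`
(`MemContDiffHolder k r`). [folklore] -/
structure HolderManifoldFunction {ι : Type*} {E : Type*} [NormedAddCommGroup E] [NormedSpace ℝ E]
    {M : Type*} [TopologicalSpace M] [ChartedSpace E M] (𝔄 : HolderChartData ι E M)
    (F : Type*) [NormedAddCommGroup F] [NormedSpace ℝ F] (k : ℕ) (r : ℝ≥0) where
  /-- The underlying function. -/
  toFun : M → F
  /-- Every chart piece is in `C^{k,r}_b(E, F)`. -/
  memContDiffHolder_piece' : ∀ i, MemContDiffHolder k r (𝔄.piece toFun i)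

namespace HolderManifoldFunction

variable {ι : Type*} {E : Type*} [NormedAddCommGroup E] [NormedSpace ℝ E]
  {M : Type*} [TopologicalSpace M] [ChartedSpace E M] {𝔄 : HolderChartData ι E M}
  {F : Type*} [NormedAddCommGroup F] [NormedSpace ℝ F] {k : ℕ} {r : ℝ≥0}

/-- `C^{k,r}_𝔄(M, F)` is a type of functions `M → F`. [folklore] -/
instance instFunLike : FunLike (HolderManifoldFunction 𝔄 F k r) M F where
  coe := toFun
  coe_injective f g h := by cases f; cases g; congr

/-- Extensionality. [folklore] -/
@[ext]
theorem ext {f g : HolderManifoldFunction 𝔄 F k r} (h : ∀ x, f x = g x) : f = g :=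
  DFunLike.ext f g h

/-- The pieces of a member are in `C^{k,r}_b`. [folklore] -/
theorem memContDiffHolder_piece (u : HolderManifoldFunction 𝔄 F k r) (i : ι) :
    MemContDiffHolder k r (𝔄.piece (u : M → F) i) := u.memContDiffHolder_piece' i

/-! #### Algebraic structure (pointwise) -/

/-- The zero function. [folklore] -/
instance instZero : Zero (HolderManifoldFunction 𝔄 F k r) :=
  ⟨⟨0, fun i => by rw [𝔄.piece_zero]; exact memContDiffHolder_zero_fun⟩⟩

/-- Pointwise addition. [folklore] -/
instance instAdd : Add (HolderManifoldFunction 𝔄 F k r) :=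
  ⟨fun u v => ⟨⇑u + ⇑v, fun i => by
    rw [𝔄.piece_add]; exact (u.memContDiffHolder_piece i).add (v.memContDiffHolder_piece i)⟩⟩

/-- Pointwise negation. [folklore] -/
instance instNeg : Neg (HolderManifoldFunction 𝔄 F k r) :=
  ⟨fun u => ⟨-⇑u, fun i => by rw [𝔄.piece_neg]; exact (u.memContDiffHolder_piece i).neg⟩⟩

/-- Pointwise subtraction. [folklore] -/
instance instSub : Sub (HolderManifoldFunction 𝔄 F k r) :=
  ⟨fun u v => ⟨⇑u - ⇑v, fun i => by
    rw [𝔄.piece_sub, sub_eq_add_neg]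
    exact (u.memContDiffHolder_piece i).add (v.memContDiffHolder_piece i).neg⟩⟩

/-- Real scalar multiplication. [folklore] -/
instance instSMul : SMul ℝ (HolderManifoldFunction 𝔄 F k r) :=
  ⟨fun a u => ⟨a • ⇑u, fun i => by
    rw [𝔄.piece_smul]; exact (u.memContDiffHolder_piece i).const_smul a⟩⟩

/-- Natural scalar multiplication (through the real one). [folklore] -/
instance instNSMul : SMul ℕ (HolderManifoldFunction 𝔄 F k r) :=
  ⟨fun n u => (n : ℝ) • u⟩

/-- Integer scalar multiplication (through the real one). [folklore] -/
instance instZSMul : SMul ℤ (HolderManifoldFunction 𝔄 F k r) :=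
  ⟨fun n u => (n : ℝ) • u⟩

/-- The zero element is the zero function. [folklore] -/
@[simp] theorem coe_zero : ((0 : HolderManifoldFunction 𝔄 F k r) : M → F) = 0 := rfl

/-- Addition is pointwise. [folklore] -/
@[simp] theorem coe_add (u v : HolderManifoldFunction 𝔄 F k r) : ⇑(u + v) = u + v := rfl

/-- Negation is pointwise. [folklore] -/
@[simp] theorem coe_neg (u : HolderManifoldFunction 𝔄 F k r) : ⇑(-u) = -u := rfl

/-- Subtraction is pointwise. [folklore] -/
@[simp] theorem coe_sub (u v : HolderManifoldFunction 𝔄 F k r) : ⇑(u - v) = u - v := rfl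

/-- Real scalar multiplication is pointwise. [folklore] -/
@[simp] theorem coe_smul (a : ℝ) (u : HolderManifoldFunction 𝔄 F k r) : ⇑(a • u) = a • u := rfl

/-- Natural scalar multiplication is pointwise. [folklore] -/
theorem coe_nsmul (n : ℕ) (u : HolderManifoldFunction 𝔄 F k r) : ⇑(n • u) = n • (u : M → F) := by
  show ((n : ℝ) • u : M → F) = n • (u : M → F)
  funext x
  simp [Nat.cast_smul_eq_nsmul]

/-- Integer scalar multiplication is pointwise. [folklore] -/
theorem coe_zsmul (n : ℤ) (u : HolderManifoldFunction 𝔄 F k r) : ⇑(n • u) = n • (u : M → F) := by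
  show ((n : ℝ) • u : M → F) = n • (u : M → F)
  funext x
  simp [Int.cast_smul_eq_zsmul]

/-- `C^{k,r}_𝔄(M, F)` is an additive commutative group (pulled back from `M → F`). [folklore] -/
instance instAddCommGroup : AddCommGroup (HolderManifoldFunction 𝔄 F k r) :=
  DFunLike.coe_injective.addCommGroup _ coe_zero coe_add coe_neg coe_sub (fun f n => coe_nsmul n f)
    (fun f n => coe_zsmul n f)

/-- The coercion to functions as an additive monoid homomorphism. [folklore] -/
def coeAddHom : HolderManifoldFunction 𝔄 F k r →+ (M → F) where
  toFun := (⇑)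
  map_zero' := coe_zero
  map_add' := coe_add

/-- `C^{k,r}_𝔄(M, F)` is a real vector space (pulled back from `M → F`). [folklore] -/
instance instModule : Module ℝ (HolderManifoldFunction 𝔄 F k r) :=
  DFunLike.coe_injective.module ℝ coeAddHom coe_smul

/-! #### The pieces map and the norm -/

/-- **The pieces map** `u ↦ (piece u i)_i : C^{k,r}_𝔄(M, F) → Π i, C^{k,r}_b(E, F)`. [folklore] -/
def toPieces (u : HolderManifoldFunction 𝔄 F k r) : (i : ι) → ContDiffHolderFunction E F k r :=
  fun i => ⟨𝔄.piece (u : M → F) i, u.memContDiffHolder_piece i⟩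

/-- The `i`-th piece, as a function, is `𝔄.piece u i`. [folklore] -/
@[simp]
theorem coe_toPieces (u : HolderManifoldFunction 𝔄 F k r) (i : ι) :
    (u.toPieces i : E → F) = 𝔄.piece (u : M → F) i := rfl

/-- `toPieces` is additive. [folklore] -/
theorem toPieces_add (u v : HolderManifoldFunction 𝔄 F k r) :
    (u + v).toPieces = u.toPieces + v.toPieces := by
  funext i
  refine ContDiffHolderFunction.ext fun y => ?_
  show 𝔄.piece (⇑u + ⇑v) i y = 𝔄.piece (u : M → F) i y + 𝔄.piece (v : M → F) i y
  rw [𝔄.piece_add]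
  rfl

/-- `toPieces` is real-homogeneous. [folklore] -/
theorem toPieces_smul (a : ℝ) (u : HolderManifoldFunction 𝔄 F k r) :
    (a • u).toPieces = a • u.toPieces := by
  funext i
  refine ContDiffHolderFunction.ext fun y => ?_
  show 𝔄.piece (a • ⇑u) i y = a • 𝔄.piece (u : M → F) i y
  rw [𝔄.piece_smul]
  rfl

/-- `toPieces` as a linear map. [folklore] -/
def toPiecesₗ : HolderManifoldFunction 𝔄 F k r →ₗ[ℝ] ((i : ι) → ContDiffHolderFunction E F k r) where
  toFun := toPieces
  map_add' := toPieces_add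
  map_smul' := toPieces_smul

/-- `toPiecesₗ u = toPieces u`. [folklore] -/
@[simp]
theorem toPiecesₗ_apply (u : HolderManifoldFunction 𝔄 F k r) : toPiecesₗ u = u.toPieces := rfl

/-- `toPieces` commutes with subtraction. [folklore] -/
theorem toPieces_sub (u v : HolderManifoldFunction 𝔄 F k r) :
    (u - v).toPieces = u.toPieces - v.toPieces :=
  map_sub toPiecesₗ u v

variable [Fintype ι]

/-- **`toPieces` is injective** (the cutoffs sum to `1`). [folklore] -/
theorem toPieces_injective : Injective (toPieces (𝔄 := 𝔄) (F := F) (k := k) (r := r)) := by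
  intro u v h
  have hp : ∀ i, 𝔄.piece (u : M → F) i = 𝔄.piece (v : M → F) i := fun i => by
    have := congrArg (fun w : (i : ι) → ContDiffHolderFunction E F k r => (w i : E → F)) h
    simpa using this
  ext x
  rw [𝔄.apply_eq_sum_indicator_piece (u : M → F) x, 𝔄.apply_eq_sum_indicator_piece (v : M → F) x]
  simp only [hp]

/-- **The norm** `‖u‖ = ‖toPieces u‖ = max_i ‖piece u i‖_{C^{k,r}}`, pulled back along the
injective linear map `toPieces`. [folklore] -/
instance instNormedAddCommGroup : NormedAddCommGroup (HolderManifoldFunction 𝔄 F k r) :=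
  NormedAddCommGroup.induced (HolderManifoldFunction 𝔄 F k r)
    ((i : ι) → ContDiffHolderFunction E F k r) toPiecesₗ toPieces_injective

/-- `C^{k,r}_𝔄(M, F)` is a real normed space. [folklore] -/
instance instNormedSpace : NormedSpace ℝ (HolderManifoldFunction 𝔄 F k r) :=
  NormedSpace.induced ℝ (HolderManifoldFunction 𝔄 F k r)
    ((i : ι) → ContDiffHolderFunction E F k r) toPiecesₗ

/-- Unfolding the norm. [folklore] -/
theorem norm_def (u : HolderManifoldFunction 𝔄 F k r) : ‖u‖ = ‖u.toPieces‖ := rfl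

/-- Each piece is bounded by the norm. [folklore] -/
theorem norm_toPieces_le (u : HolderManifoldFunction 𝔄 F k r) (i : ι) : ‖u.toPieces i‖ ≤ ‖u‖ := by
  rw [norm_def]
  exact norm_le_pi_norm _ i

/-- **Values are bounded by the norm**: `‖u x‖ ≤ card ι · ‖u‖`. [folklore] -/
theorem norm_apply_le (u : HolderManifoldFunction 𝔄 F k r) (x : M) :
    ‖u x‖ ≤ Fintype.card ι * ‖u‖ := by
  rw [𝔄.apply_eq_sum_indicator_piece (u : M → F) x]
  refine (norm_sum_le _ _).trans ?_
  have h : ∀ i, ‖(𝔄.chart i).source.indicator (fun x => 𝔄.piece (u : M → F) i (𝔄.chart i x)) x‖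
      ≤ ‖u‖ := fun i => by
    refine (norm_indicator_le_norm_self _ x).trans ?_
    exact ((u.toPieces i).norm_apply_le_norm (𝔄.chart i x)).trans (u.norm_toPieces_le i)
  calc ∑ i, ‖(𝔄.chart i).source.indicator (fun x => 𝔄.piece (u : M → F) i (𝔄.chart i x)) x‖
      ≤ ∑ _i : ι, ‖u‖ := Finset.sum_le_sum fun i _ => h i
    _ = Fintype.card ι * ‖u‖ := by rw [Finset.sum_const, nsmul_eq_mul, Finset.card_univ]

/-! #### Completeness -/

/-- **`C^{k,r}_𝔄(M, F)` is a Banach space for complete `F`.** Along a Cauchy sequence `u` the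
pieces converge in `Π i, C^{k,r}_b(E, F)` (complete, part 3) to some `w`; the function
`v x = ∑ i 𝟙_{source_i}(x) · w i (chart_i x)` is the pointwise limit of the `u n`
(`apply_eq_sum_indicator_piece`), and its pieces are the `w i` (both are pointwise limits of the
pieces of `u n`), so `v ∈ C^{k,r}_𝔄` and `‖u n − v‖ = ‖toPieces (u n) − w‖ → 0`. [folklore] -/
instance instCompleteSpace [CompleteSpace F] : CompleteSpace (HolderManifoldFunction 𝔄 F k r) := by
  refine Metric.complete_of_cauchySeq_tendsto fun u hu => ?_
  -- the pieces converge
  have hc : CauchySeq fun n => (u n).toPieces := by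
    refine Metric.cauchySeq_iff.2 fun ε hε => ?_
    obtain ⟨N, hN⟩ := Metric.cauchySeq_iff.1 hu ε hε
    refine ⟨N, fun m hm n hn => ?_⟩
    have h := hN m hm n hn
    rwa [dist_eq_norm, norm_def, toPieces_sub, ← dist_eq_norm] at h
  obtain ⟨w, hw⟩ := cauchySeq_tendsto_of_complete hc
  -- pointwise limits of the pieces
  have hwpt : ∀ i y, Tendsto (fun n => 𝔄.piece (u n : M → F) i y) atTop (𝓝 (w i y)) := by
    intro i y
    have h1 : Tendsto (fun n => (u n).toPieces i) atTop (𝓝 (w i)) :=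
      ((continuous_apply i).tendsto w).comp hw
    exact ((ContDiffHolderFunction.evalCLM (E := E) (F := F) (k := k) (r := r) y).continuous.tendsto
      (w i)).comp h1
  -- the limit function
  set v : M → F := fun x => ∑ i, (𝔄.chart i).source.indicator (fun x => w i (𝔄.chart i x)) x
    with hvdef
  have hv : ∀ x, Tendsto (fun n => u n x) atTop (𝓝 (v x)) := by
    intro x
    have hrepr : (fun n => u n x) = fun n => ∑ i,
        (𝔄.chart i).source.indicator (fun x => 𝔄.piece (u n : M → F) i (𝔄.chart i x)) x :=
      funext fun n => 𝔄.apply_eq_sum_indicator_piece (u n : M → F) x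
    rw [hrepr]
    refine tendsto_finsetSum _ fun i _ => ?_
    by_cases hx : x ∈ (𝔄.chart i).source
    · simp only [indicator_of_mem hx]
      exact hwpt i _
    · simp only [indicator_of_notMem hx]
      exact tendsto_const_nhds
  -- its pieces are the limits of the pieces
  have hpiece : ∀ i, 𝔄.piece v i = (w i : E → F) := by
    intro i
    funext y
    by_cases hy : y ∈ (𝔄.chart i).target
    · rw [𝔄.piece_apply_of_mem v hy]
      have h1 : Tendsto (fun n => 𝔄.ρ i ((𝔄.chart i).symm y) • u n ((𝔄.chart i).symm y)) atTop
          (𝓝 (𝔄.ρ i ((𝔄.chart i).symm y) • v ((𝔄.chart i).symm y))) :=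
        (hv _).const_smul _
      have h2 : Tendsto (fun n => 𝔄.ρ i ((𝔄.chart i).symm y) • u n ((𝔄.chart i).symm y)) atTop
          (𝓝 (w i y)) := by
        refine (hwpt i y).congr fun n => ?_
        exact 𝔄.piece_apply_of_mem (u n : M → F) hy
      exact tendsto_nhds_unique h1 h2
    · rw [𝔄.piece_apply_of_not_mem v hy]
      have h2 : Tendsto (fun _ : ℕ => (0 : F)) atTop (𝓝 (w i y)) := by
        refine (hwpt i y).congr fun n => ?_
        exact 𝔄.piece_apply_of_not_mem (u n : M → F) hy
      exact tendsto_nhds_unique tendsto_const_nhds h2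
  set V : HolderManifoldFunction 𝔄 F k r :=
    ⟨v, fun i => by rw [hpiece i]; exact (w i).memContDiffHolder⟩ with hV
  have hVw : V.toPieces = w := funext fun i => ContDiffHolderFunction.ext fun y => by
    show 𝔄.piece v i y = w i y
    rw [hpiece i]
  refine ⟨V, ?_⟩
  rw [tendsto_iff_norm_sub_tendsto_zero]
  have h := tendsto_iff_norm_sub_tendsto_zero.1 hw
  refine h.congr fun n => ?_
  rw [norm_def, toPieces_sub, hVw]

end HolderManifoldFunction

/-! ### Smooth functions are members -/

namespace HolderChartData

variable {ι : Type*} {E : Type*} [NormedAddCommGroup E] [NormedSpace ℝ E]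
  {M : Type*} [TopologicalSpace M] [ChartedSpace E M] [IsManifold 𝓘(ℝ, E) ∞ M]
  {F : Type*} [NormedAddCommGroup F] [NormedSpace ℝ F]
  (𝔄 : HolderChartData ι E M)

/-- The smooth integrand of a piece: `y ↦ ρ_i(chart⁻¹ y) • u(chart⁻¹ y)` is `C^∞` on the chart
target for `C^∞` `u`. [folklore] -/
theorem contDiffOn_piece_integrand {u : M → F} (hu : ContMDiff 𝓘(ℝ, E) 𝓘(ℝ, F) ∞ u) (i : ι) :
    ContDiffOn ℝ ∞ (fun y => 𝔄.ρ i ((𝔄.chart i).symm y) • u ((𝔄.chart i).symm y))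
      (𝔄.chart i).target := by
  rw [← contMDiffOn_iff_contDiffOn]
  have hsymm : ContMDiffOn 𝓘(ℝ, E) 𝓘(ℝ, E) ∞ (𝔄.chart i).symm (𝔄.chart i).target :=
    contMDiffOn_chart_symm
  exact ((𝔄.ρ i).contMDiff.comp_contMDiffOn hsymm).smul (hu.comp_contMDiffOn hsymm)

omit [IsManifold 𝓘(ℝ, E) ∞ M] in
/-- The support of a piece lies in the (compact) image of the support of the cutoff. [folklore] -/
theorem tsupport_piece_subset [CompactSpace M] [T2Space E] (u : M → F) (i : ι) :
    tsupport (𝔄.piece u i) ⊆ 𝔄.chart i '' tsupport (𝔄.ρ i) := by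
  have hK : IsCompact (𝔄.chart i '' tsupport (𝔄.ρ i)) :=
    ((isClosed_tsupport _).isCompact).image_of_continuousOn
      ((𝔄.chart i).continuousOn.mono (𝔄.isSubordinate i))
  refine closure_minimal (fun y hy => ?_) hK.isClosed
  have hyt : y ∈ (𝔄.chart i).target := by
    by_contra h
    exact hy (𝔄.piece_apply_of_not_mem u h)
  have hρ : 𝔄.ρ i ((𝔄.chart i).symm y) ≠ 0 := by
    intro h
    apply hy
    rw [𝔄.piece_apply_of_mem u hyt, h, zero_smul]
  exact ⟨(𝔄.chart i).symm y, subset_closure hρ, (𝔄.chart i).right_inv hyt⟩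

omit [IsManifold 𝓘(ℝ, E) ∞ M] in
/-- The image of the support of the cutoff is a compact subset of the chart target. [folklore] -/
theorem isCompact_image_tsupport [CompactSpace M] (i : ι) :
    IsCompact (𝔄.chart i '' tsupport (𝔄.ρ i)) ∧ 𝔄.chart i '' tsupport (𝔄.ρ i) ⊆ (𝔄.chart i).target :=
  ⟨((isClosed_tsupport _).isCompact).image_of_continuousOn
      ((𝔄.chart i).continuousOn.mono (𝔄.isSubordinate i)),
    by
      rintro _ ⟨x, hx, rfl⟩
      exact (𝔄.chart i).map_source (𝔄.isSubordinate i hx)⟩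

/-- **A piece of a `C^∞` function is `C^∞` on the whole model space** (it is `C^∞` on the open
chart target and vanishes near its complement). [folklore] -/
theorem contDiff_piece [CompactSpace M] [T2Space E] {u : M → F}
    (hu : ContMDiff 𝓘(ℝ, E) 𝓘(ℝ, F) ∞ u) (i : ι) : ContDiff ℝ ∞ (𝔄.piece u i) := by
  rw [contDiff_iff_contDiffAt]
  intro y
  by_cases hy : y ∈ (𝔄.chart i).target
  · have hev : 𝔄.piece u i =ᶠ[𝓝 y]
        fun y => 𝔄.ρ i ((𝔄.chart i).symm y) • u ((𝔄.chart i).symm y) := by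
      filter_upwards [(𝔄.chart i).open_target.mem_nhds hy] with z hz
      exact 𝔄.piece_apply_of_mem u hz
    refine ContDiffAt.congr_of_eventuallyEq ?_ hev
    exact (𝔄.contDiffOn_piece_integrand hu i).contDiffAt ((𝔄.chart i).open_target.mem_nhds hy)
  · have hyK : y ∉ tsupport (𝔄.piece u i) := fun h =>
      hy ((𝔄.isCompact_image_tsupport i).2 (𝔄.tsupport_piece_subset u i h))
    have hev : 𝔄.piece u i =ᶠ[𝓝 y] 0 := notMem_tsupport_iff_eventuallyEq.1 hyK
    exact (contDiffAt_const (c := (0 : F))).congr_of_eventuallyEq hev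

omit [IsManifold 𝓘(ℝ, E) ∞ M] in
/-- A piece of a function has compact support (compact manifold). [folklore] -/
theorem hasCompactSupport_piece [CompactSpace M] [T2Space E] (u : M → F) (i : ι) :
    HasCompactSupport (𝔄.piece u i) :=
  (𝔄.isCompact_image_tsupport i).1.of_isClosed_subset (isClosed_tsupport _)
    (𝔄.tsupport_piece_subset u i)

/-- The derivatives of a piece of a `C^∞` function are bounded. [folklore] -/
theorem eSupNorm_iteratedFDeriv_piece_lt_top [CompactSpace M] [T2Space E] {u : M → F}
    (hu : ContMDiff 𝓘(ℝ, E) 𝓘(ℝ, F) ∞ u) (i : ι) (j : ℕ) :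
    eSupNorm (iteratedFDeriv ℝ j (𝔄.piece u i)) < ⊤ := by
  have hcont : Continuous (iteratedFDeriv ℝ j (𝔄.piece u i)) :=
    (𝔄.contDiff_piece hu i).continuous_iteratedFDeriv (by exact_mod_cast le_top)
  have hsupp : HasCompactSupport (iteratedFDeriv ℝ j (𝔄.piece u i)) :=
    (𝔄.hasCompactSupport_piece u i).iteratedFDeriv j
  obtain ⟨C, hC⟩ := hcont.bounded_above_of_compact_support hsupp
  exact eSupNorm_lt_top_iff.2 ⟨C, hC⟩

/-- **The pieces of a `C^∞` function on a compact manifold are in `C^{k,r}_b` for `r ≤ 1`**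
(bounded derivatives of all orders; the `k`-th derivative is Lipschitz and bounded, hence
`r`-Hölder, `holderWith_iteratedFDeriv_of_eSupNorm_ne_top`). [folklore] -/
theorem memContDiffHolder_piece_of_contMDiff [CompactSpace M] [T2Space E] {u : M → F}
    (hu : ContMDiff 𝓘(ℝ, E) 𝓘(ℝ, F) ∞ u) {k : ℕ} {r : ℝ≥0} (hr : r ≤ 1) (i : ι) :
    MemContDiffHolder k r (𝔄.piece u i) := by
  refine ⟨(𝔄.contDiff_piece hu i).of_le (by exact_mod_cast le_top),
    fun j _ => 𝔄.eSupNorm_iteratedFDeriv_piece_lt_top hu i j, ?_⟩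
  exact (holderWith_iteratedFDeriv_of_eSupNorm_ne_top
    ((𝔄.contDiff_piece hu i).of_le (by exact_mod_cast le_top))
    (𝔄.eSupNorm_iteratedFDeriv_piece_lt_top hu i (k + 1)).ne
    (𝔄.eSupNorm_iteratedFDeriv_piece_lt_top hu i k).ne hr).memHolder

end HolderChartData

namespace HolderManifoldFunction

variable {ι : Type*} {E : Type*} [NormedAddCommGroup E] [NormedSpace ℝ E]
  {M : Type*} [TopologicalSpace M] [ChartedSpace E M] [IsManifold 𝓘(ℝ, E) ∞ M]
  [CompactSpace M] [T2Space E] {𝔄 : HolderChartData ι E M}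
  {F : Type*} [NormedAddCommGroup F] [NormedSpace ℝ F] {k : ℕ} {r : ℝ≥0}

/-- **`C^∞` functions on a compact manifold are in `C^{k,r}_𝔄(M, F)`** for every `k` and `r ≤ 1`. [folklore] -/
def ofContMDiff (u : M → F) (hu : ContMDiff 𝓘(ℝ, E) 𝓘(ℝ, F) ∞ u) (hr : r ≤ 1) :
    HolderManifoldFunction 𝔄 F k r :=
  ⟨u, fun i => 𝔄.memContDiffHolder_piece_of_contMDiff hu hr i⟩

/-- The underlying function of `ofContMDiff u _ _` is `u`. [folklore] -/
@[simp]
theorem coe_ofContMDiff (u : M → F) (hu : ContMDiff 𝓘(ℝ, E) 𝓘(ℝ, F) ∞ u) (hr : r ≤ 1) :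
    ((ofContMDiff (𝔄 := 𝔄) (k := k) u hu hr : HolderManifoldFunction 𝔄 F k r) : M → F) = u := rfl

end HolderManifoldFunction

end Literature.Analysis.FunctionSpaces

end
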